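import Literature.AlgebraicGeometry.HodgeTheory.DivisorLefschetzGroup
import Literature.AlgebraicGeometry.Milne1999.DivisorClassesSymmetricCentralizer
import Literature.AlgebraicGeometry.Milne1999.SpecialLefschetzGroupInvariantsHodgeClasses
import HarnessLib

/-!
# `G_div(X)` is the LARGEST subgroup of `Gl(V)` leaving all divisor classes in `H²(X, ℚ) = ⋀²V` invariant,
# and does not depend on the polarization — Moonen–Zarhin 1998 §1, on the carrier (PROVED)

Layer `Literature/AlgebraicGeometry/HodgeTheory`; THEOREMS ONLY (no definition, no named fact; D-0026 net
debt 0). Sequel of `HodgeTheory/DivisorLefschetzGroup` (the print's group `G_div(X)(ℂ) = divisorLefschetzGroup A h`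
and its `S_λ ⊗ ℂ = symmetricPullbackSpan A h`; there: `G_div(X)(ℂ)` FIXES the divisor classes) and of
`Milne1999/DivisorClassesSymmetricCentralizer` (the Néron–Severi ↔ Rosati-symmetric dictionary `c ↦ T_c` on the
carriers), which are combined into the converse.

## The print

B. J. J. Moonen, Yu. G. Zarhin, *Weil classes on abelian varieties*, J. reine angew. Math. **496** (1998) =
arXiv:alg-geom/9612017 [MoonenZarhin1998WeilClasses], §1 (held chunk p0002 L53–L80), VERBATIM: «We define the
algebraic group `G_div(X) ⊆ SP(V, φ)` as the centralizer of `B` in `SP(V, φ)`. More precisely,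
`G_div(X) := Gl_B(V) ∩ SP(V, φ)`. Of course, the main motivation for introducing this group `G_div(X)` is the
fact that it is the largest algebraic subgroup of `Gl(V)` defined over `ℚ` which leaves invariant all divisor
classes in `H²(X, ℚ) = ⋀²V`. In fact, the divisor classes, viewed as alternating bilinear forms on `V`, are
precisely the forms `φ_s : (v₁, v₂) ↦ φ(s · v₁, v₂)` for `s ∈ S_λ`. The group `G_div(X)` does not depend on the
choice of `λ`.»

## What is proved (the carrier `V ⊗ ℂ = H¹(A(ℂ); ℂ)`, `H² = ⋀²H¹`, `End⁰(X) ⊗ ℂ` acting by the `φ^*`)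

For a complex abelian variety `A` and a class `h ∈ B¹(A) ⊗ ℂ = hodgeClassSpan (dim A) A.X 1` whose polarization
pairing `Q_h(x, y) = h^{dim A - 1} ∪ x ∪ y` is non-degenerate on `H¹(A(ℂ); ℂ)` (every polarization class:
`Milne1999.eq_zero_of_forall_polarizationPairingOne_eq_zero_of_hasHardLefschetzProperty`):

* **`mem_symmetricPullbackSpan_iff_exists_contractionOp_eq`**, **`symmetricPullbackSpan_eq_map_contractionOp`** —
  «the divisor classes, viewed as alternating bilinear forms on `V`, are precisely the forms `φ_s`, `s ∈ S_λ`»: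
  for the scalar symplectic form `B = λ ∘ Q_h` (`λ` an injective functional on the top-degree line), the
  `Q_h`-self-adjoint `ℂ`-combinations of pull-backs are EXACTLY the contraction operators
  `T_c = ι_{B(v,·)} c` of the classes `c ∈ B¹(A) ⊗ ℂ` (`Milne1999.contractionOp`; `φ_{T_c}(v, w) = B(T_c v, w)` is
  the alternating form of the `2`-vector `c` transported along `B♭`), and `c ↦ T_c` is injective; hence
  **`finrank_symmetricPullbackSpan_eq`**: `dim_ℂ (S_λ ⊗ ℂ) = dim_ℂ (B¹(A) ⊗ ℂ)` (`NS_ℚ(X) ≅ End⁰(X)^{sym}`,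
  Lange–Birkenhake Prop. 5.2.1 / Mumford §21, read on the carrier).
* **`mem_divisorLefschetzGroup_iff_forall_exteriorPullback_eq`** — «largest»: an automorphism `u` of
  `H¹(A(ℂ); ℂ)` lies in `G_div(X)(ℂ)` IF AND ONLY IF `⋀²u` fixes every class of `B¹(A) ⊗ ℂ`. (`⟹` is
  `DivisorLefschetzGroup`'s `exteriorPullback_two_eq_self_of_mem_divisorLefschetzGroup`; `⟸`,
  **`mem_divisorLefschetzGroup_of_forall_exteriorPullback_eq`**: `⋀²u` fixes the Kähler class `h₀` of a
  projective embedding, `h₀^{dim A} ≠ 0`, so `det u = 1` and `u` preserves `Q_h` (`⋀²u h = h`,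
  `Q_h(ux, uy) = ⋀^{2 dim A}u (Q_h(x, y)) = det u · Q_h(x, y)`); `u` is then a `B`-isometry, so
  `T_c ∘ u = T_{⋀²u c} ∘ u = u ∘ T_c` for every `c ∈ B¹(A) ⊗ ℂ`, i.e. `u` commutes with all of `S_λ ⊗ ℂ`.) The
  symplectic condition «`⊆ SP(V, φ)`» is thus automatic for the stabiliser of the divisor classes, and so is
  «defined over `ℚ`» in the print (not formalised: no `ℚ`-structure on the carrier group).
* **`divisorLefschetzGroup_eq_of_mem_hodgeClassSpan`** — «The group `G_div(X)` does not depend on the choice of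
  `λ`»: `divisorLefschetzGroup A h = divisorLefschetzGroup A h'` for any two such classes.
* **`mem_divisorLefschetzGroup_iff_forall_exteriorPullback_eq'`**, **`divisorLefschetzGroup_eq_of_isPolarization'`** —
  the same for `h` rational of type `(1,1)` with the hard Lefschetz property (`dim A ≥ 1`).
* Lemma (3) (chunk p0003 L4–L5) «`(⋀²V_X)^{G_div(X)} = B¹(X)`» PROVED:
  **`mem_hodgeClassSpan_iff_forall_mem_divisorLefschetzGroup`** (and with `𝒟¹`,
  `mem_divisorClassesSpan_one_iff_forall_mem_divisorLefschetzGroup`); of «`(⊕ᵢ ⋀ⁱV_X)^{G_div(X)} = 𝒟•(X)`» the parts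
  that hold without invariant theory: the `G_div(X)(ℂ)`-invariants of every `H^{2p}` are Hodge classes
  (**`mem_hodgeClassSpan_of_forall_mem_divisorLefschetzGroup`**, `S(A)(h)(ℂ) ≤ G_div(X)(ℂ)` + Deligne I 3.4), they
  contain `𝒟ᵖ ⊗ ℂ` (`DivisorLefschetzGroup`), and vanish in odd degrees
  (**`eq_zero_of_forall_mem_divisorLefschetzGroup_of_odd`**).

NOT here: `G_div(X)` as an algebraic group over `ℚ`; «`B` does not depend on `λ`» (only `G_div` is treated);
Lemma (3) `End(V_X)^{G_div(X)} = B` (the double commutant) and `(⋀^{2p}V_X)^{G_div(X)} ⊆ 𝒟ᵖ(X)` for `p ≥ 2`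
(«classical invariant theory … easy variants of [Kum1]»); Table 1.

## References

* [MoonenZarhin1998WeilClasses] B. J. J. Moonen, Yu. G. Zarhin, J. reine angew. Math. 496 (1998) =
  arXiv:alg-geom/9612017, §1 (definition of `S_λ`, `B`, `G_div(X)`, «largest algebraic subgroup … divisor
  classes», «does not depend on the choice of `λ`»; chunk p0002 L53–L80).
* [Milne1999LefschetzClasses] J. S. Milne, Duke Math. J. 96 (1999), §1 pp. 642–644 (e_D, †, Prop. 1.3), §3
  Prop. 3.3, Thm. 4.4 (p. 659).
* [LangeBirkenhake1992] H. Lange, Ch. Birkenhake, *Complex Abelian Varieties*, Lemma 1.1.17 (`H• = ⋀•H¹`), §2.5,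
  Prop. 5.2.1 (`NS_ℚ(X) ≅ End⁰(X)^{sym}`), §5.1 (Rosati = adjoint).
* [MumfordAV1970] D. Mumford, *Abelian Varieties*, §21 Application III (p. 208).
* [Deligne1982HodgeCycles] P. Deligne, LNM 900 (1982), I §3 Prop. 3.4.
* [vanGeemen1994HodgeAV] B. van Geemen, in: LNM 1594 (1994), 6.5 (the Hodge group acts on `⋀•V`).
* [VoisinHodgeI2002] C. Voisin, *Hodge Theory and Complex Algebraic Geometry I*, §3.1.3 Cor. 3.9, §6.2.3, §7.1.2.
* [HatcherAT2002] A. Hatcher, *Algebraic Topology*, §3.2 Prop. 3.10, Thm. 3.11.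

## Provenance

Lane `lit-hodgefound` (Track 2, Layer A), prover seat `lit-hodgefound-p21` (generation 14), row g14-#1: the
«NOT here: largest» clause of `DivisorLefschetzGroup` (g13-#6) discharged with the seat `lit-milne`'s dictionary.
-/

noncomputable section

open CategoryTheory
open Literature.AlgebraicTopology.SingularHomology
open Literature.AlgebraicGeometry.Motives
open Literature.AlgebraicGeometry.VanGeemen1994 (pullbackOne hodgeGroupOne mem_hodgeGroupOne_iff hodgeClassSpan)
open Literature.AlgebraicGeometry.Milne1999 (centralizerAlgebra unitaryCentralizerGroup
  hodgeGroupOne_le_unitaryCentralizerGroup contractionOp contractionOp_injective contractionOp_exteriorPullback_apply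
  mem_bicommutant_iff_mem_span exists_mem_hodgeClassSpan_contractionOp_eq contractionOp_mem_bicommutant
  bilin_contractionOp_apply exists_bilinForm_isAlt_nondegenerate)
open Literature.Barriers.HodgeConjecture (divisorClassesSpan)
open Literature.Geometry.Kaehler (HasHardLefschetzProperty)

namespace Literature.AlgebraicGeometry.HodgeTheory

variable {A : AbelianVariety ℂ} {h : complexBetti A.X 2}

/-! ## Part 1. The scalar symplectic form `B = λ ∘ Q_h` and `S_λ ⊗ ℂ` -/

section BilinForm

variable {B : LinearMap.BilinForm ℂ (complexBetti A.X 1)}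
  {lam : complexBetti A.X (2 + 2 * (A.dim - 1)) →ₗ[ℂ] ℂ}

/-- For `B = λ ∘ Q_h` with `λ` injective, `Q_h`-self-adjointness of an endomorphism `T` of `H¹(A(ℂ); ℂ)` is
`B`-symmetry. [cite: LangeBirkenhake1992, Lemma 1.7.4 and §5.1] -/
theorem forall_polarizationPairingOne_apply_eq_iff_of_bilinForm (hlam : Function.Injective lam)
    (hB : ∀ a c, B a c = lam (polarizationPairingOne A.X h (A.dim - 1) a c))
    (T : Module.End ℂ (complexBetti A.X 1)) :
    (∀ x y : complexBetti A.X 1, polarizationPairingOne A.X h (A.dim - 1) (T x) y =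
        polarizationPairingOne A.X h (A.dim - 1) x (T y)) ↔
      ∀ x y : complexBetti A.X 1, B (T x) y = B x (T y) :=
  ⟨fun H x y ↦ by rw [hB, hB, H], fun H x y ↦ hlam (by rw [← hB, ← hB, H])⟩

/-- For `B = λ ∘ Q_h` with `λ` injective, an automorphism preserves `Q_h` iff it preserves `B`.
[cite: LangeBirkenhake1992, Lemma 1.7.4 and §5.1] -/
theorem forall_polarizationPairingOne_apply_apply_eq_iff_of_bilinForm (hlam : Function.Injective lam)
    (hB : ∀ a c, B a c = lam (polarizationPairingOne A.X h (A.dim - 1) a c))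
    (u : complexBetti A.X 1 ≃ₗ[ℂ] complexBetti A.X 1) :
    (∀ x y : complexBetti A.X 1, polarizationPairingOne A.X h (A.dim - 1) (u x) (u y) =
        polarizationPairingOne A.X h (A.dim - 1) x y) ↔
      ∀ x y : complexBetti A.X 1, B (u x) (u y) = B x y :=
  ⟨fun H x y ↦ by rw [hB, hB, H], fun H x y ↦ hlam (by rw [← hB, ← hB, H])⟩

/-- `B = λ ∘ Q_h` is preserved by the Hodge group when `h ∈ B¹(A) ⊗ ℂ` (`Hg(A)(ℂ)|_{H¹} ≤ S(A)(h)(ℂ)` preserves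
`Q_h`). [cite: Milne1999LefschetzClasses, §4 Prop. 4.8 (p. 660)] -/
theorem bilinForm_apply_one_apply_one_eq_of_mem_hodgeGroup (hh : h ∈ hodgeClassSpan A.dim A.X 1)
    (hB : ∀ a c, B a c = lam (polarizationPairingOne A.X h (A.dim - 1) a c)) :
    ∀ g ∈ hodgeGroup A.dim A.X, ∀ v w : complexBetti A.X 1, B (g 1 v) (g 1 w) = B v w := fun g hg v w ↦ by
  rw [hB, hB, (hodgeGroupOne_le_unitaryCentralizerGroup hh (mem_hodgeGroupOne_iff.2 ⟨g, hg, rfl⟩)).2 v w]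

/-- **`S_λ ⊗ ℂ` through `B = λ ∘ Q_h`**: `T ∈ symmetricPullbackSpan A h` iff `T` lies in the bicommutant `E''` of
the pull-backs (`=` their `ℂ`-span, `End⁰(X) ⊗ ℂ` acting; Milne Remark 1.2 with Riemann's theorem) and is
`B`-symmetric. [cite: MoonenZarhin1998WeilClasses, §1 (definition of S_λ; chunk p0002)]
[cite: Milne1999LefschetzClasses, §1 Remark 1.2 (p. 643)] -/
theorem mem_symmetricPullbackSpan_iff_of_bilinForm (hlam : Function.Injective lam)
    (hB : ∀ a c, B a c = lam (polarizationPairingOne A.X h (A.dim - 1) a c))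
    {T : Module.End ℂ (complexBetti A.X 1)} :
    T ∈ symmetricPullbackSpan A h ↔
      T ∈ Subalgebra.centralizer ℂ (centralizerAlgebra A : Set (Module.End ℂ (complexBetti A.X 1))) ∧
        ∀ x y : complexBetti A.X 1, B (T x) y = B x (T y) := by
  rw [mem_symmetricPullbackSpan_iff, mem_bicommutant_iff_mem_span,
    forall_polarizationPairingOne_apply_eq_iff_of_bilinForm hlam hB]

/-- **`T_c ∈ S_λ ⊗ ℂ` for `c ∈ B¹(A) ⊗ ℂ`** (`dim A ≥ 1`, `h ∈ B¹(A) ⊗ ℂ`, `B = λ ∘ Q_h` alternating with `λ`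
injective): the contraction operator of a divisor class is a `Q_h`-self-adjoint combination of pull-backs — the
map «divisor class `↦ φ_s`» lands in `S_λ`. [cite: MoonenZarhin1998WeilClasses, §1 («the divisor classes … are precisely the forms φ_s for s ∈ S_λ»; chunk p0002)]
[cite: Milne1999LefschetzClasses, §1 Prop. 1.3 and Remark 1.2] -/
theorem contractionOp_mem_symmetricPullbackSpan (hn : 1 ≤ A.dim) (hh : h ∈ hodgeClassSpan A.dim A.X 1)
    (hBalt : B.IsAlt) (hlam : Function.Injective lam)
    (hB : ∀ a c, B a c = lam (polarizationPairingOne A.X h (A.dim - 1) a c))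
    {c : complexBetti A.X 2} (hc : c ∈ hodgeClassSpan A.dim A.X 1) :
    contractionOp A B c ∈ symmetricPullbackSpan A h :=
  (mem_symmetricPullbackSpan_iff_of_bilinForm hlam hB).2
    ⟨contractionOp_mem_bicommutant hn (bilinForm_apply_one_apply_one_eq_of_mem_hodgeGroup hh hB) hc,
      bilin_contractionOp_apply hBalt c⟩

/-- **Every element of `S_λ ⊗ ℂ` is a `T_c`, `c ∈ B¹(A) ⊗ ℂ`** (`dim A ≥ 1`, `h ∈ B¹(A) ⊗ ℂ`, `B = λ ∘ Q_h`
alternating non-degenerate, `λ` injective): Milne's Prop. 1.3 / 3.3 on the carriers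
(`Milne1999.exists_mem_hodgeClassSpan_contractionOp_eq`) read for the `Q_h`-self-adjoint span — the map
«divisor class `↦ φ_s`» is ONTO `S_λ`. [cite: MoonenZarhin1998WeilClasses, §1 («… are precisely the forms φ_s for s ∈ S_λ»; chunk p0002)]
[cite: Milne1999LefschetzClasses, §1 Prop. 1.3 and §3 Prop. 3.3] [cite: LangeBirkenhake1992, Prop. 5.2.1] -/
theorem exists_mem_hodgeClassSpan_contractionOp_eq_of_mem_symmetricPullbackSpan (hn : 1 ≤ A.dim)
    (hh : h ∈ hodgeClassSpan A.dim A.X 1) (hBalt : B.IsAlt) (hBnd : B.Nondegenerate)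
    (hlam : Function.Injective lam) (hB : ∀ a c, B a c = lam (polarizationPairingOne A.X h (A.dim - 1) a c))
    {T : Module.End ℂ (complexBetti A.X 1)} (hT : T ∈ symmetricPullbackSpan A h) :
    ∃ c ∈ hodgeClassSpan A.dim A.X 1, contractionOp A B c = T := by
  obtain ⟨hTE, hTsym⟩ := (mem_symmetricPullbackSpan_iff_of_bilinForm hlam hB).1 hT
  exact exists_mem_hodgeClassSpan_contractionOp_eq hn hBalt hBnd
    (bilinForm_apply_one_apply_one_eq_of_mem_hodgeGroup hh hB) hTE hTsym

/-- **«The divisor classes, viewed as alternating bilinear forms on `V`, are precisely the forms `φ_s`,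
`s ∈ S_λ`», on the carrier**: for `dim A ≥ 1`, `h ∈ B¹(A) ⊗ ℂ` and `B = λ ∘ Q_h` alternating non-degenerate
(`λ` injective), `T ∈ S_λ ⊗ ℂ` iff `T = T_c` for some `c ∈ B¹(A) ⊗ ℂ` (unique: `Milne1999.contractionOp_injective`).
[cite: MoonenZarhin1998WeilClasses, §1 (chunk p0002 L72–L76)] [cite: Milne1999LefschetzClasses, §1 Prop. 1.3 and §3 Prop. 3.3]
[cite: MumfordAV1970, §21 Application III] -/
theorem mem_symmetricPullbackSpan_iff_exists_contractionOp_eq (hn : 1 ≤ A.dim)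
    (hh : h ∈ hodgeClassSpan A.dim A.X 1) (hBalt : B.IsAlt) (hBnd : B.Nondegenerate)
    (hlam : Function.Injective lam) (hB : ∀ a c, B a c = lam (polarizationPairingOne A.X h (A.dim - 1) a c))
    {T : Module.End ℂ (complexBetti A.X 1)} :
    T ∈ symmetricPullbackSpan A h ↔ ∃ c ∈ hodgeClassSpan A.dim A.X 1, contractionOp A B c = T := by
  refine ⟨exists_mem_hodgeClassSpan_contractionOp_eq_of_mem_symmetricPullbackSpan hn hh hBalt hBnd hlam hB, ?_⟩
  rintro ⟨c, hc, rfl⟩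
  exact contractionOp_mem_symmetricPullbackSpan hn hh hBalt hlam hB hc

/-- **`S_λ ⊗ ℂ = T(B¹(A) ⊗ ℂ)`** as subspaces of `End(H¹(A(ℂ); ℂ))` (`dim A ≥ 1`, `h ∈ B¹(A) ⊗ ℂ`, `B = λ ∘ Q_h`
alternating non-degenerate, `λ` injective). [cite: MoonenZarhin1998WeilClasses, §1 (chunk p0002 L72–L76)]
[cite: Milne1999LefschetzClasses, §3 Prop. 3.3] [cite: LangeBirkenhake1992, Prop. 5.2.1] -/
theorem symmetricPullbackSpan_eq_map_contractionOp (hn : 1 ≤ A.dim) (hh : h ∈ hodgeClassSpan A.dim A.X 1)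
    (hBalt : B.IsAlt) (hBnd : B.Nondegenerate) (hlam : Function.Injective lam)
    (hB : ∀ a c, B a c = lam (polarizationPairingOne A.X h (A.dim - 1) a c)) :
    symmetricPullbackSpan A h = (hodgeClassSpan A.dim A.X 1).map (contractionOp A B) := by
  ext T
  rw [mem_symmetricPullbackSpan_iff_exists_contractionOp_eq hn hh hBalt hBnd hlam hB, Submodule.mem_map]

end BilinForm

/-- **`dim_ℂ (S_λ ⊗ ℂ) = dim_ℂ (B¹(A) ⊗ ℂ)`** — the Picard number is the dimension of the `†`-symmetric part
of `End⁰(X)` (`NS_ℚ(X) ≅ End⁰(X)^{sym}`), on the carrier: for `dim A ≥ 1` and `h ∈ B¹(A) ⊗ ℂ` with `Q_h`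
non-degenerate, `c ↦ T_c` (for `B = λ ∘ Q_h`) is a linear bijection `B¹(A) ⊗ ℂ → S_λ ⊗ ℂ`.
[cite: LangeBirkenhake1992, Prop. 5.2.1] [cite: MumfordAV1970, §21 Application III]
[cite: MoonenZarhin1998WeilClasses, §1 (chunk p0002 L72–L76)] -/
theorem finrank_symmetricPullbackSpan_eq (hn : 1 ≤ A.dim) (hh : h ∈ hodgeClassSpan A.dim A.X 1)
    (hnd : ∀ x : complexBetti A.X 1, (∀ y, polarizationPairingOne A.X h (A.dim - 1) x y = 0) → x = 0) :
    Module.finrank ℂ (symmetricPullbackSpan A h) = Module.finrank ℂ (hodgeClassSpan A.dim A.X 1) := by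
  obtain ⟨B, hBalt, hBnd, lam, hlam, hB⟩ := exists_bilinForm_isAlt_nondegenerate (A := A) hnd
  rw [symmetricPullbackSpan_eq_map_contractionOp hn hh hBalt hBnd hlam hB]
  exact (Submodule.equivMapOfInjective _ (contractionOp_injective hBnd) _).finrank_eq.symm

/-! ## Part 2. «Largest»: the stabiliser of the divisor classes is `G_div(X)(ℂ)` -/

/-- In dimension `0`, `H¹(A(ℂ); ℂ) = 0` and every automorphism of it lies in `G_div(X)(ℂ)`. [folklore] -/
private theorem mem_divisorLefschetzGroup_of_dim_eq_zero (hA : A.dim = 0)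
    (u : complexBetti A.X 1 ≃ₗ[ℂ] complexBetti A.X 1) : u ∈ divisorLefschetzGroup A h := by
  haveI : Module.Finite ℂ (complexBetti A.X 1) := abelianVarietyCohomologyExteriorH1_holds.finite_one A
  have hV : Module.finrank ℂ (complexBetti A.X 1) = 0 := by
    rw [AbelianVariety.finrank_complexBetti_one, hA, mul_zero]
  haveI : Subsingleton (complexBetti A.X 1) := Module.finrank_zero_iff.1 hV
  have hu : ∀ x, u x = x := fun x ↦ Subsingleton.elim _ _
  exact ⟨fun T _ x ↦ by rw [hu, hu], fun x y ↦ by rw [hu, hu]⟩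

/-- **An automorphism of `H¹(A(ℂ); ℂ)` whose exterior square fixes `B¹(A) ⊗ ℂ` has determinant `1`**: it fixes
the rational Kähler class `h₀` of a projective embedding, so `⋀u` fixes `h₀^{dim A} ≠ 0`, on which it acts by
`det u`. [cite: LangeBirkenhake1992, Lemma 1.1.17 and §2.5] [cite: VoisinHodgeI2002, §3.1.3 Cor. 3.9 and §7.1.2] -/
theorem det_eq_one_of_forall_exteriorPullback_eq {u : complexBetti A.X 1 ≃ₗ[ℂ] complexBetti A.X 1}
    (hu : ∀ c ∈ hodgeClassSpan A.dim A.X 1,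
      exteriorPullback (AbelianVariety.hasExteriorCohomologyH1_complexPoints A)
        (u : complexBetti A.X 1 →ₗ[ℂ] complexBetti A.X 1) 2 c = c) :
    LinearMap.det (u : complexBetti A.X 1 →ₗ[ℂ] complexBetti A.X 1) = 1 := by
  haveI : Module.Finite ℂ (complexBetti A.X 1) := abelianVarietyCohomologyExteriorH1_holds.finite_one A
  have hΛ := AbelianVariety.hasExteriorCohomologyH1_complexPoints A
  rcases Nat.eq_zero_or_pos A.dim with hA | hn
  · have hV : Module.finrank ℂ (complexBetti A.X 1) = 0 := by
      rw [AbelianVariety.finrank_complexBetti_one, hA, mul_zero]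
    exact LinearMap.det_eq_one_of_finrank_eq_zero hV _
  obtain ⟨D⟩ := nonempty_kaehlerRationalDatum (AbelianVariety.isSmoothProjective_holds (A := A))
  have hK : IsKaehlerClass A.dim A.X D.Hη := D.isKaehlerClassVia.isKaehlerClass D.isNatural D.isMultiplicative
  have hh₀ : D.Hη ∈ hodgeClassSpan A.dim A.X 1 :=
    Submodule.subset_span (show D.Hη ∈ {c : complexBetti A.X (2 * 1) | IsRationalClass c ∧
      IsOfHodgeType A.dim A.X (2 * 1) 1 1 c} from ⟨D.isRationalClass_Hη, hK.isOfHodgeType_one_one⟩)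
  have hpow : cupPowTwo D.Hη A.dim ≠ 0 :=
    hK.cupPowTwo_ne_zero (AbelianVariety.isSmoothProjective_holds (A := A)) hn le_rfl
  have e := Milne1999.exteriorPullback_cupPowTwo hΛ (hu _ hh₀) A.dim
  rw [Milne1999.exteriorPullback_top hΛ _ (AbelianVariety.finrank_complexBetti_one A)] at e
  exact smul_left_injective ℂ hpow (e.trans (one_smul ℂ _).symm)

/-- **An automorphism of `H¹(A(ℂ); ℂ)` whose exterior square fixes `B¹(A) ⊗ ℂ` preserves `Q_h`** for every
`h ∈ B¹(A) ⊗ ℂ`: `Q_h(ux, uy) = h^{dim A - 1} ∪ ux ∪ uy = ⋀^{2 dim A}u (h^{dim A - 1} ∪ x ∪ y) = det u · Q_h(x, y)`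
with `⋀²u h = h` and `det u = 1` — the «`⊆ SP(V, φ)`» half of «largest».
[cite: MoonenZarhin1998WeilClasses, §1 («largest algebraic subgroup … divisor classes»; chunk p0002)]
[cite: LangeBirkenhake1992, Lemma 1.1.17 and Exercise 1.1.6 (7)–(8)] -/
theorem polarizationPairingOne_apply_apply_eq_of_forall_exteriorPullback_eq (hh : h ∈ hodgeClassSpan A.dim A.X 1)
    {u : complexBetti A.X 1 ≃ₗ[ℂ] complexBetti A.X 1}
    (hu : ∀ c ∈ hodgeClassSpan A.dim A.X 1,
      exteriorPullback (AbelianVariety.hasExteriorCohomologyH1_complexPoints A)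
        (u : complexBetti A.X 1 →ₗ[ℂ] complexBetti A.X 1) 2 c = c)
    (x y : complexBetti A.X 1) :
    polarizationPairingOne A.X h (A.dim - 1) (u x) (u y) = polarizationPairingOne A.X h (A.dim - 1) x y := by
  haveI : Module.Finite ℂ (complexBetti A.X 1) := abelianVarietyCohomologyExteriorH1_holds.finite_one A
  have hΛ := AbelianVariety.hasExteriorCohomologyH1_complexPoints A
  rcases Nat.eq_zero_or_pos A.dim with hA | hn
  · exact (mem_divisorLefschetzGroup_of_dim_eq_zero (h := h) hA u).2 x y
  have hdet := det_eq_one_of_forall_exteriorPullback_eq hu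
  have hU2 := hu h hh
  have hxy : cupProduct (rfl : 1 + 1 = 2) (u x) (u y) =
      exteriorPullback hΛ (u : complexBetti A.X 1 →ₗ[ℂ] complexBetti A.X 1) 2
        (cupProduct (rfl : 1 + 1 = 2) x y) := by
    rw [Milne1999.exteriorPullback_cupProduct_one_one, LinearEquiv.coe_coe]
  rw [polarizationPairingOne_apply, polarizationPairingOne_apply, hxy,
    ← Milne1999.exteriorPullback_lefschetzPow hΛ hU2 2 _ (A.dim - 1),
    Milne1999.exteriorPullback_top hΛ _ (d := 2 + 2 * (A.dim - 1))
      (by rw [AbelianVariety.finrank_complexBetti_one]; omega), hdet, one_smul]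

/-- **«`G_div(X)` is the largest subgroup of `Gl(V)` which leaves invariant all divisor classes in
`H²(X, ℚ) = ⋀²V`», the inclusion, PROVED on the carrier.** For a complex abelian variety `A`, a class
`h ∈ B¹(A) ⊗ ℂ` with `Q_h` non-degenerate on `H¹(A(ℂ); ℂ)`, and an automorphism `u` of `H¹(A(ℂ); ℂ)` such that
`⋀²u c = c` for every `c ∈ B¹(A) ⊗ ℂ = hodgeClassSpan (dim A) A.X 1`: `u ∈ divisorLefschetzGroup A h = G_div(X)(ℂ)`.
Proof: `u` preserves `Q_h` (`polarizationPairingOne_apply_apply_eq_of_forall_exteriorPullback_eq`), hence the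
scalar symplectic form `B = λ ∘ Q_h`; for `T ∈ S_λ ⊗ ℂ` write `T = T_c` with `c ∈ B¹(A) ⊗ ℂ` (the dictionary,
`exists_mem_hodgeClassSpan_contractionOp_eq_of_mem_symmetricPullbackSpan`); then
`T_c(u v) = T_{⋀²u c}(u v) = u(T_c v)` (`Milne1999.contractionOp_exteriorPullback_apply`).
[cite: MoonenZarhin1998WeilClasses, §1 («largest algebraic subgroup of Gl(V) … which leaves invariant all divisor classes»; chunk p0002 L68–L76)]
[cite: Milne1999LefschetzClasses, §1 Prop. 1.3, §3 Prop. 3.3 and Thm. 4.4 (proof, p. 659)] -/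
theorem mem_divisorLefschetzGroup_of_forall_exteriorPullback_eq (hh : h ∈ hodgeClassSpan A.dim A.X 1)
    (hnd : ∀ x : complexBetti A.X 1, (∀ y, polarizationPairingOne A.X h (A.dim - 1) x y = 0) → x = 0)
    {u : complexBetti A.X 1 ≃ₗ[ℂ] complexBetti A.X 1}
    (hu : ∀ c ∈ hodgeClassSpan A.dim A.X 1,
      exteriorPullback (AbelianVariety.hasExteriorCohomologyH1_complexPoints A)
        (u : complexBetti A.X 1 →ₗ[ℂ] complexBetti A.X 1) 2 c = c) :
    u ∈ divisorLefschetzGroup A h := by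
  rcases Nat.eq_zero_or_pos A.dim with hA | hn
  · exact mem_divisorLefschetzGroup_of_dim_eq_zero hA u
  have hQ := polarizationPairingOne_apply_apply_eq_of_forall_exteriorPullback_eq hh hu
  obtain ⟨B, hBalt, hBnd, lam, hlam, hB⟩ := exists_bilinForm_isAlt_nondegenerate (A := A) hnd
  have huB : ∀ v w : complexBetti A.X 1, B (u v) (u w) = B v w :=
    (forall_polarizationPairingOne_apply_apply_eq_iff_of_bilinForm hlam hB u).1 hQ
  refine ⟨fun T hT x ↦ ?_, hQ⟩
  obtain ⟨c, hc, rfl⟩ :=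
    exists_mem_hodgeClassSpan_contractionOp_eq_of_mem_symmetricPullbackSpan hn hh hBalt hBnd hlam hB hT
  have e := contractionOp_exteriorPullback_apply u huB c x
  rw [hu c hc] at e
  exact e.symm

/-- `G_div(X)(ℂ)` fixes `B¹(A) ⊗ ℂ` pointwise (`DivisorLefschetzGroup`'s theorem for rational `(1,1)`-classes,
extended to their span). [cite: MoonenZarhin1998WeilClasses, §1 (chunk p0002 L72–L76)] -/
theorem exteriorPullback_eq_self_of_mem_hodgeClassSpan_of_mem_divisorLefschetzGroup
    (hh : h ∈ hodgeClassSpan A.dim A.X 1)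
    (hnd : ∀ x : complexBetti A.X 1, (∀ y, polarizationPairingOne A.X h (A.dim - 1) x y = 0) → x = 0)
    {u : complexBetti A.X 1 ≃ₗ[ℂ] complexBetti A.X 1} (hu : u ∈ divisorLefschetzGroup A h)
    {c : complexBetti A.X 2} (hc : c ∈ hodgeClassSpan A.dim A.X 1) :
    exteriorPullback (AbelianVariety.hasExteriorCohomologyH1_complexPoints A)
      (u : complexBetti A.X 1 →ₗ[ℂ] complexBetti A.X 1) 2 c = c := by
  induction hc using Submodule.span_induction with
  | mem x hx => exact exteriorPullback_two_eq_self_of_mem_divisorLefschetzGroup hh hnd hu hx.1 hx.2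
  | zero => exact map_zero _
  | add x y _ _ hx hy => rw [map_add, hx, hy]
  | smul r x _ hx => rw [map_smul, hx]

/-- **«`G_div(X)` is the largest subgroup of `Gl(V)` which leaves invariant all divisor classes in
`H²(X, ℚ) = ⋀²V`», PROVED on the carrier as an equivalence**: for `h ∈ B¹(A) ⊗ ℂ` with `Q_h` non-degenerate on
`H¹(A(ℂ); ℂ)`, an automorphism `u` of `H¹(A(ℂ); ℂ)` lies in `G_div(X)(ℂ) = divisorLefschetzGroup A h` iff `⋀²u`
fixes every class of `B¹(A) ⊗ ℂ`. [cite: MoonenZarhin1998WeilClasses, §1 (chunk p0002 L68–L76)]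
[cite: Milne1999LefschetzClasses, §3 Prop. 3.3 and Thm. 4.4 (proof, p. 659)] -/
theorem mem_divisorLefschetzGroup_iff_forall_exteriorPullback_eq (hh : h ∈ hodgeClassSpan A.dim A.X 1)
    (hnd : ∀ x : complexBetti A.X 1, (∀ y, polarizationPairingOne A.X h (A.dim - 1) x y = 0) → x = 0)
    {u : complexBetti A.X 1 ≃ₗ[ℂ] complexBetti A.X 1} :
    u ∈ divisorLefschetzGroup A h ↔ ∀ c ∈ hodgeClassSpan A.dim A.X 1,
      exteriorPullback (AbelianVariety.hasExteriorCohomologyH1_complexPoints A)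
        (u : complexBetti A.X 1 →ₗ[ℂ] complexBetti A.X 1) 2 c = c :=
  ⟨fun hu _ hc ↦ exteriorPullback_eq_self_of_mem_hodgeClassSpan_of_mem_divisorLefschetzGroup hh hnd hu hc,
    mem_divisorLefschetzGroup_of_forall_exteriorPullback_eq hh hnd⟩

/-- **«The group `G_div(X)` does not depend on the choice of `λ`», PROVED on the carrier**: for two classes
`h, h' ∈ B¹(A) ⊗ ℂ` with non-degenerate polarization pairings, `divisorLefschetzGroup A h = divisorLefschetzGroup A h'`
(both are the stabiliser of `B¹(A) ⊗ ℂ`). [cite: MoonenZarhin1998WeilClasses, §1 («The group G_div(X) does not depend on the choice of λ»; chunk p0002 L78)] -/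
theorem divisorLefschetzGroup_eq_of_mem_hodgeClassSpan {h' : complexBetti A.X 2}
    (hh : h ∈ hodgeClassSpan A.dim A.X 1)
    (hnd : ∀ x : complexBetti A.X 1, (∀ y, polarizationPairingOne A.X h (A.dim - 1) x y = 0) → x = 0)
    (hh' : h' ∈ hodgeClassSpan A.dim A.X 1)
    (hnd' : ∀ x : complexBetti A.X 1, (∀ y, polarizationPairingOne A.X h' (A.dim - 1) x y = 0) → x = 0) :
    divisorLefschetzGroup A h = divisorLefschetzGroup A h' := by
  ext u
  rw [mem_divisorLefschetzGroup_iff_forall_exteriorPullback_eq hh hnd,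
    mem_divisorLefschetzGroup_iff_forall_exteriorPullback_eq hh' hnd']

/-! ### Polarization-class spellings (`h` rational, of type `(1,1)`, hard Lefschetz; `dim A ≥ 1`) -/

/-- A rational `(1,1)`-class lies in `B¹(A) ⊗ ℂ`. [cite: VoisinHodgeI2002, §7.1.2 and §11.3.2] -/
private theorem mem_hodgeClassSpan_of_isRationalClass' (hQ : IsRationalClass h)
    (h11 : IsOfHodgeType A.dim A.X 2 1 1 h) : h ∈ hodgeClassSpan A.dim A.X 1 :=
  Submodule.subset_span
    (show h ∈ {c : complexBetti A.X (2 * 1) | IsRationalClass c ∧ IsOfHodgeType A.dim A.X (2 * 1) 1 1 c}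
      from ⟨hQ, h11⟩)

/-- **«Largest», for a polarization class** (`dim A ≥ 1`, `h` rational of type `(1,1)` with the hard Lefschetz
property): `u ∈ divisorLefschetzGroup A h` iff `⋀²u` fixes `B¹(A) ⊗ ℂ` pointwise.
[cite: MoonenZarhin1998WeilClasses, §1 (chunk p0002 L68–L76)] [cite: VoisinHodgeI2002, §6.2.3 (hard Lefschetz)] -/
theorem mem_divisorLefschetzGroup_iff_forall_exteriorPullback_eq' (h1 : 1 ≤ A.dim) (hQ : IsRationalClass h)
    (h11 : IsOfHodgeType A.dim A.X 2 1 1 h) (hHL : HasHardLefschetzProperty h A.dim)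
    {u : complexBetti A.X 1 ≃ₗ[ℂ] complexBetti A.X 1} :
    u ∈ divisorLefschetzGroup A h ↔ ∀ c ∈ hodgeClassSpan A.dim A.X 1,
      exteriorPullback (AbelianVariety.hasExteriorCohomologyH1_complexPoints A)
        (u : complexBetti A.X 1 →ₗ[ℂ] complexBetti A.X 1) 2 c = c :=
  mem_divisorLefschetzGroup_iff_forall_exteriorPullback_eq (mem_hodgeClassSpan_of_isRationalClass' hQ h11)
    fun _ hx ↦ Milne1999.eq_zero_of_forall_polarizationPairingOne_eq_zero_of_hasHardLefschetzProperty h1 hHL hx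

/-- **Independence of the polarization, for polarization classes** (`dim A ≥ 1`; `h`, `h'` rational of type
`(1,1)` with the hard Lefschetz property): `divisorLefschetzGroup A h = divisorLefschetzGroup A h'`.
[cite: MoonenZarhin1998WeilClasses, §1 («does not depend on the choice of λ»; chunk p0002 L78)] -/
theorem divisorLefschetzGroup_eq_of_isPolarization' {h' : complexBetti A.X 2} (h1 : 1 ≤ A.dim)
    (hQ : IsRationalClass h) (h11 : IsOfHodgeType A.dim A.X 2 1 1 h) (hHL : HasHardLefschetzProperty h A.dim)
    (hQ' : IsRationalClass h') (h11' : IsOfHodgeType A.dim A.X 2 1 1 h')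
    (hHL' : HasHardLefschetzProperty h' A.dim) :
    divisorLefschetzGroup A h = divisorLefschetzGroup A h' :=
  divisorLefschetzGroup_eq_of_mem_hodgeClassSpan (mem_hodgeClassSpan_of_isRationalClass' hQ h11)
    (fun _ hx ↦ Milne1999.eq_zero_of_forall_polarizationPairingOne_eq_zero_of_hasHardLefschetzProperty h1 hHL hx)
    (mem_hodgeClassSpan_of_isRationalClass' hQ' h11')
    (fun _ hx ↦ Milne1999.eq_zero_of_forall_polarizationPairingOne_eq_zero_of_hasHardLefschetzProperty h1 hHL' hx)

/-- **`S(A)(h)(ℂ) ≤ G_div(X)(ℂ)` sharpened: Milne's group is the part of the stabiliser of `B¹(A) ⊗ ℂ` commuting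
with ALL pull-backs** — for `h ∈ B¹(A) ⊗ ℂ` with `Q_h` non-degenerate, `u ∈ unitaryCentralizerGroup A h` iff `u`
commutes with every `φ^*` and `⋀²u` fixes `B¹(A) ⊗ ℂ`. [cite: Milne1999LefschetzClasses, §1 p. 644 and Thm. 4.4 (p. 659)]
[cite: MoonenZarhin1998WeilClasses, §1 (chunk p0002)] -/
theorem mem_unitaryCentralizerGroup_iff_forall_exteriorPullback_eq (hh : h ∈ hodgeClassSpan A.dim A.X 1)
    (hnd : ∀ x : complexBetti A.X 1, (∀ y, polarizationPairingOne A.X h (A.dim - 1) x y = 0) → x = 0)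
    {u : complexBetti A.X 1 ≃ₗ[ℂ] complexBetti A.X 1} :
    u ∈ unitaryCentralizerGroup A h ↔ u ∈ Milne1999.centralizerGroup A ∧ ∀ c ∈ hodgeClassSpan A.dim A.X 1,
      exteriorPullback (AbelianVariety.hasExteriorCohomologyH1_complexPoints A)
        (u : complexBetti A.X 1 →ₗ[ℂ] complexBetti A.X 1) 2 c = c := by
  refine ⟨fun hu ↦ ⟨hu.1, (mem_divisorLefschetzGroup_iff_forall_exteriorPullback_eq hh hnd).1
    (unitaryCentralizerGroup_le_divisorLefschetzGroup hu)⟩, fun ⟨hc, hfix⟩ ↦ ⟨hc, ?_⟩⟩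
  exact polarizationPairingOne_apply_apply_eq_of_forall_exteriorPullback_eq hh hfix

/-! ## Part 3. Lemma (3): «`(⋀²V_X)^{G_div(X)} = B¹(X)`» (PROVED) and «`(⊕ᵢ ⋀ⁱV_X)^{G_div(X)} = 𝒟•(X)`»
(the invariants are Hodge classes; odd degrees vanish) -/

/-- **The `G_div(X)(ℂ)`-invariants of `H^{2p}(A(ℂ); ℂ)` are Hodge classes** (`⊆ Bᵖ(A) ⊗ ℂ`), for any
`h ∈ B¹(A) ⊗ ℂ`: `S(A)(h)(ℂ) ≤ G_div(X)(ℂ)` and the `S(A)(h)(ℂ)`-invariants are Hodge classes (the tree's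
`Milne1999.mem_hodgeClassSpan_of_forall_exteriorPullback_eq`: `Hg(A)(ℂ)|_{H¹} ≤ S(A)(h)(ℂ)`, Deligne I 3.4) — the
inclusion `(⊕ᵢ ⋀^{2i}V_X)^{G_div(X)} ⊆ ℬ•(X) ⊗ ℂ` towards Lemma (3)'s third clause (whose `⊇ 𝒟•(X)` is
`DivisorLefschetzGroup`'s `exteriorPullback_eq_self_of_mem_divisorClassesSpan_of_mem_divisorLefschetzGroup`; `=`
needs the invariant theory of [Kum1]). [cite: MoonenZarhin1998WeilClasses, §1 Lemma (3) (chunk p0003 L4–L5)]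
[cite: Milne1999LefschetzClasses, §4 p. 660 (`L(A) ⊃ Hg(A)`)] [cite: Deligne1982HodgeCycles, I §3 Prop. 3.4] -/
theorem mem_hodgeClassSpan_of_forall_mem_divisorLefschetzGroup (hh : h ∈ hodgeClassSpan A.dim A.X 1) {p : ℕ}
    {x : complexBetti A.X (2 * p)}
    (hx : ∀ u ∈ divisorLefschetzGroup A h,
      exteriorPullback (AbelianVariety.hasExteriorCohomologyH1_complexPoints A)
        (u : complexBetti A.X 1 →ₗ[ℂ] complexBetti A.X 1) (2 * p) x = x) :
    x ∈ hodgeClassSpan A.dim A.X p :=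
  Milne1999.mem_hodgeClassSpan_of_forall_exteriorPullback_eq hh fun u hu ↦
    hx u (unitaryCentralizerGroup_le_divisorLefschetzGroup hu)

/-- **Lemma (3), second clause «`(⋀²V_X)^{G_div(X)} = B¹(X)`», PROVED on the carrier**: for `h ∈ B¹(A) ⊗ ℂ`
with `Q_h` non-degenerate on `H¹(A(ℂ); ℂ)`, a class `c ∈ H²(A(ℂ); ℂ) = ⋀²H¹` lies in `B¹(A) ⊗ ℂ` iff `⋀²u c = c`
for every `u ∈ G_div(X)(ℂ) = divisorLefschetzGroup A h`.
[cite: MoonenZarhin1998WeilClasses, §1 Lemma (3) («(⋀² V_X)^{G_div(X)} = B¹(X)»; chunk p0003 L4–L5)]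
[cite: Milne1999LefschetzClasses, §3 Prop. 3.3] [cite: Deligne1982HodgeCycles, I §3 Prop. 3.4] -/
theorem mem_hodgeClassSpan_iff_forall_mem_divisorLefschetzGroup (hh : h ∈ hodgeClassSpan A.dim A.X 1)
    (hnd : ∀ x : complexBetti A.X 1, (∀ y, polarizationPairingOne A.X h (A.dim - 1) x y = 0) → x = 0)
    {c : complexBetti A.X 2} :
    c ∈ hodgeClassSpan A.dim A.X 1 ↔ ∀ u ∈ divisorLefschetzGroup A h,
      exteriorPullback (AbelianVariety.hasExteriorCohomologyH1_complexPoints A)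
        (u : complexBetti A.X 1 →ₗ[ℂ] complexBetti A.X 1) 2 c = c :=
  ⟨fun hc _ hu ↦ exteriorPullback_eq_self_of_mem_hodgeClassSpan_of_mem_divisorLefschetzGroup hh hnd hu hc,
    fun hc ↦ mem_hodgeClassSpan_of_forall_mem_divisorLefschetzGroup (p := 1) hh hc⟩

/-- **Lemma (3), third clause in degree `2`: «`(⋀²V_X)^{G_div(X)} = 𝒟¹(X)`»** (`𝒟¹ = B¹`, Lefschetz `(1,1)`), on
the carrier with `divisorClassesSpan A.X (dim A) 1`. [cite: MoonenZarhin1998WeilClasses, §1 Lemma (3) (chunk p0003 L4–L5)]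
[cite: Milne1999LefschetzClasses, §3 Prop. 3.3] -/
theorem mem_divisorClassesSpan_one_iff_forall_mem_divisorLefschetzGroup (hh : h ∈ hodgeClassSpan A.dim A.X 1)
    (hnd : ∀ x : complexBetti A.X 1, (∀ y, polarizationPairingOne A.X h (A.dim - 1) x y = 0) → x = 0)
    {c : complexBetti A.X 2} :
    c ∈ divisorClassesSpan A.X A.dim 1 ↔ ∀ u ∈ divisorLefschetzGroup A h,
      exteriorPullback (AbelianVariety.hasExteriorCohomologyH1_complexPoints A)
        (u : complexBetti A.X 1 →ₗ[ℂ] complexBetti A.X 1) 2 c = c := by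
  rw [Milne1999.divisorClassesSpan_one_eq_hodgeClassSpan_one]
  exact mem_hodgeClassSpan_iff_forall_mem_divisorLefschetzGroup hh hnd

/-- **Lemma (3), third clause in odd degrees: only `0` is `G_div(X)(ℂ)`-invariant in `H^k(A(ℂ); ℂ)`, `k` odd**
(any `h ∈ B¹(A) ⊗ ℂ`): a Hodge-group element `g` acts on `H^k = ⋀^kH¹` by `⋀^k g₁` (van Geemen 6.5, the tree's
`hodgeGroup_apply_cupPowOne`) with `g₁ ∈ Hg(A)(ℂ)|_{H¹} ≤ G_div(X)(ℂ)`, and in odd degree only `0` is fixed by the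
Hodge group (Deligne I 3.4; equivalently `-1 ∈ G_div(X)(ℂ)` acts by `(-1)^k`).
[cite: MoonenZarhin1998WeilClasses, §1 Lemma (3) (chunk p0003 L4–L5)] [cite: vanGeemen1994HodgeAV, 6.5]
[cite: Deligne1982HodgeCycles, I §3 Prop. 3.4] -/
theorem eq_zero_of_forall_mem_divisorLefschetzGroup_of_odd (hh : h ∈ hodgeClassSpan A.dim A.X 1) {k : ℕ}
    (hk : Odd k) {x : complexBetti A.X k}
    (hx : ∀ u ∈ divisorLefschetzGroup A h,
      exteriorPullback (AbelianVariety.hasExteriorCohomologyH1_complexPoints A)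
        (u : complexBetti A.X 1 →ₗ[ℂ] complexBetti A.X 1) k x = x) :
    x = 0 := by
  refine Deligne1982.eq_zero_of_forall_hodgeGroup_apply_eq_of_odd
    (AbelianVariety.isSmoothProjective_holds (A := A)) hk fun g hg ↦ ?_
  have hu : g 1 ∈ divisorLefschetzGroup A h :=
    hodgeGroupOne_le_divisorLefschetzGroup hh (mem_hodgeGroupOne_iff.2 ⟨g, hg, rfl⟩)
  have key : (g k : complexBetti A.X k →ₗ[ℂ] complexBetti A.X k) =
      exteriorPullback (AbelianVariety.hasExteriorCohomologyH1_complexPoints A)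
        (g 1 : complexBetti A.X 1 →ₗ[ℂ] complexBetti A.X 1) k := by
    refine exteriorPullback_ext (AbelianVariety.hasExteriorCohomologyH1_complexPoints A) fun v ↦ ?_
    rw [LinearEquiv.coe_coe, hodgeGroup_apply_cupPowOne hg, exteriorPullback_cupPowOne]
    rfl
  have e := hx (g 1) hu
  rwa [← key, LinearEquiv.coe_coe] at e

end Literature.AlgebraicGeometry.HodgeTheory

end
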